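import Mathlib
import Summits.Ventures.HodgeRepro2.T5LocalFieldHaar
import Summits.Ventures.HodgeRepro2.T5EpsilonLocalField

/-!
# `ℚ_p` IS the local-field object: the datum's degree-one place `F_𝔭 = ℚ_p`

Blind cell `pub-hodge-repro2`, seat p7 (gen 9), Tier-5 kernel support for N5 / §G [R-4] and S0
(route/T5-LEAN-p7.md §22, second addendum: what remained of the modelling clause (b)(iv) was the
reading «`F_v` is Mathlib's local-field object»; route/T5-CHECK-G-p7.md S0 / §12.2 rows P1.2, P1.9:
the datum's `𝔭` has degree one, `[F_𝔭 : ℚ_p] = 1`, so `F_𝔭 = ℚ_p` — and `p` splits completely in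
`E`, so every `E_w = ℚ_p` as well).

Mathlib's `ℚ_[p]` is a complete `NontriviallyNormedField` with `IsUltrametricDist`; this file
shows that its integer ring `𝒪[ℚ_[p]] = Valued.integer ℚ_[p]` is `ℤ_[p]`
(`integer_eq_subring`, `integerEquiv`), hence a DISCRETE VALUATION RING with FINITE residue field
`𝓀[ℚ_[p]] ≃ ℤ/pℤ` (`residueFieldEquivZMod`, `card_residueField : |𝓀| = p`) with uniformiser `p`
(`irreducible_p`).  So every hypothesis of `T5LocalFieldHaar` / `T5EpsilonLocalField` is MET by
`K = ℚ_[p]` — the reading «`F_𝔭` is this object» is a theorem at the degree-one place, modulo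
only «the completion of `F` at a degree-one `𝔭` is `ℚ_p`» (standard; prose):

* `haar_span_p_pow`: `vol(p^n ℤ_p) = p^{−n}` for the Haar probability measure of `ℤ_p`;
* `epsShape_mul_epsShape_inv_padic`: (T1) `ε(s, ω, ψ) ε(1 − s, ω⁻¹, ψ) = ω(m1)` on `ℚ_p` with
  `q = p` and Kudla's self-dual normalisation, every measure / cardinality hypothesis discharged.

README §8(d): uses an L-value-free non-vanishing device: NO.
-/

namespace Summit.Ventures.HodgeRepro2.T5PadicLocalField

open scoped NormedField Valued ENNReal
open Ideal

variable (p : ℕ) [Fact p.Prime]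

/-- `𝒪[ℚ_p] = ℤ_p` as subrings of `ℚ_p` (both are `{x ∣ ‖x‖ ≤ 1}`). -/
theorem integer_eq_subring : (Valued.integer ℚ_[p] : Subring ℚ_[p]) = PadicInt.subring p := by
  ext x
  rw [Valued.integer.mem_iff, PadicInt.mem_subring_iff]

/-- The ring isomorphism `𝒪[ℚ_p] ≃+* ℤ_p`. -/
noncomputable def integerEquiv : 𝒪[ℚ_[p]] ≃+* ℤ_[p] :=
  RingEquiv.subringCongr (integer_eq_subring p)

/-- `𝒪[ℚ_p]` is a discrete valuation ring (transported from `ℤ_p`). -/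
instance isDiscreteValuationRing_integer : IsDiscreteValuationRing 𝒪[ℚ_[p]] :=
  IsDiscreteValuationRing.RingEquivClass.isDiscreteValuationRing (integerEquiv p).symm

/-- The residue field of `𝒪[ℚ_p]` is `ℤ/pℤ`. -/
noncomputable def residueFieldEquivZMod : 𝓀[ℚ_[p]] ≃+* ZMod p :=
  (IsLocalRing.ResidueField.mapEquiv (integerEquiv p)).trans PadicInt.residueField

/-- The residue field of `𝒪[ℚ_p]` is finite. -/
instance finite_residueField : Finite 𝓀[ℚ_[p]] :=
  Finite.of_equiv (ZMod p) (residueFieldEquivZMod p).symm.toEquiv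

/-- `|𝓀[ℚ_p]| = p`. -/
theorem card_residueField : Nat.card 𝓀[ℚ_[p]] = p := by
  rw [Nat.card_congr (residueFieldEquivZMod p).toEquiv, Nat.card_zmod]

/-- `p` is a uniformiser of `𝒪[ℚ_p]` (transported from `PadicInt.irreducible_p`). -/
theorem irreducible_p : Irreducible ((p : ℕ) : 𝒪[ℚ_[p]]) := by
  rw [← MulEquiv.irreducible_iff (integerEquiv p).toMulEquiv]
  simpa using PadicInt.irreducible_p (p := p)

section Measure

variable [MeasurableSpace ℚ_[p]] [BorelSpace ℚ_[p]]

/-- `vol(p^n ℤ_p) = p^{−n}` for the Haar probability measure of `ℤ_p = 𝒪[ℚ_p]`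
(`T5LocalFieldHaar.haarProb_span_pow_eq_inv_pow` at `K = ℚ_p`, `q = p`). -/
theorem haar_span_p_pow (n : ℕ) :
    T5LocalFieldHaar.haar (K := ℚ_[p])
        ((span {((p : ℕ) : 𝒪[ℚ_[p]]) ^ n} : Ideal 𝒪[ℚ_[p]]) : Set 𝒪[ℚ_[p]]) =
      ((p : ℝ≥0∞) ^ n)⁻¹ := by
  rw [T5LocalFieldHaar.haarProb_span_pow_eq_inv_pow (irreducible_p p) n, card_residueField]

/-- `vol(1 + p^n ℤ_p) = p^{−n}`. -/
theorem haar_coset_one_add_p_pow (n : ℕ) :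
    T5LocalFieldHaar.haar (K := ℚ_[p])
        {x : 𝒪[ℚ_[p]] | x - 1 ∈ (span {((p : ℕ) : 𝒪[ℚ_[p]]) ^ n} : Ideal 𝒪[ℚ_[p]])} =
      ((p : ℝ≥0∞) ^ n)⁻¹ := by
  rw [T5LocalFieldHaar.haarProb_coset_one_add_eq_inv_pow (irreducible_p p) n, card_residueField]

/-- `vol(ℤ_pˣ) = 1 − p⁻¹`. -/
theorem haar_setOf_isUnit :
    T5LocalFieldHaar.haar (K := ℚ_[p]) {x : 𝒪[ℚ_[p]] | IsUnit x} = 1 - ((p : ℝ≥0∞))⁻¹ := by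
  rw [T5LocalFieldHaar.haarProb_setOf_isUnit (irreducible_p p), card_residueField]

/-- **(T1) on `ℚ_p`** with `q = p`, the uniformiser `p`, Kudla's self-dual normalisation: every
measure / cardinality / finiteness hypothesis of the chain is discharged by Mathlib's `ℚ_[p]`;
what remains are the printed-shape data of row 13, the two conductor conditions, `hG` / `hG'`
(the printed `G(ω^{±1}|_U)` IS Kudla's integral) and `ω(m1) = ω'(−1)`. -/
theorem epsShape_mul_epsShape_inv_padic {m : ℕ} {Kx : Type*} [CommGroup Kx]
    [Fintype (𝒪[ℚ_[p]] ⧸ span {((p : ℕ) : 𝒪[ℚ_[p]]) ^ (m + 1)})] (U : Subgroup Kx) (ϖ' : Kx)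
    (ν : ℕ) (n : ℤ) (c : (Kx →* ℂˣ) → ℕ) (G : (U →* ℂˣ) → ℂ) (s : ℂ) (ω : Kx →* ℂˣ) (m1 : Kx)
    (hc : c ω⁻¹ = c ω) {ω' : 𝒪[ℚ_[p]]ˣ →* ℂˣ}
    (hex : ∃ n, T5PrincipalUnitFiltration.higherUnits ((p : ℕ) : 𝒪[ℚ_[p]]) n ≤ ω'.ker)
    (hω : T5ConductorArithmetic.conductor
      (T5PrincipalUnitFiltration.higherUnits ((p : ℕ) : 𝒪[ℚ_[p]])) ω' = m + 1)
    (h₁ : T5PrincipalUnitFiltration.higherUnits ((p : ℕ) : 𝒪[ℚ_[p]]) (m + 1) ≤ ω'.ker)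
    (h₂ : T5PrincipalUnitFiltration.higherUnits ((p : ℕ) : 𝒪[ℚ_[p]]) (m + 1) ≤ ω'⁻¹.ker)
    (Ψ : AddChar ℚ_[p] ℂ)
    (hΨ : ∀ x : 𝒪[ℚ_[p]], Ψ (algebraMap 𝒪[ℚ_[p]] ℚ_[p] x *
      algebraMap 𝒪[ℚ_[p]] ℚ_[p] ((p : ℕ) : 𝒪[ℚ_[p]]) ^
        (((m + 1 : ℕ) : ℤ) - ((ν + (m + 1) : ℕ) : ℤ))) = 1)
    {y : 𝒪[ℚ_[p]]} (hy : Ψ (algebraMap 𝒪[ℚ_[p]] ℚ_[p] y *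
      algebraMap 𝒪[ℚ_[p]] ℚ_[p] ((p : ℕ) : 𝒪[ℚ_[p]]) ^ ((m : ℤ) - ((ν + (m + 1) : ℕ) : ℤ))) ≠ 1)
    (hG : G (ω.restrict U) = T5SelfDualGaussSum.kudlaGaussSumSelfDual
      (T5LocalFieldHaar.haar (K := ℚ_[p])) (p : ℝ) ν (irreducible_p p) ω' h₁ Ψ)
    (hG' : G (ω⁻¹.restrict U) = T5SelfDualGaussSum.kudlaGaussSumSelfDual
      (T5LocalFieldHaar.haar (K := ℚ_[p])) (p : ℝ) ν (irreducible_p p) ω'⁻¹ h₂ Ψ)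
    (hm : (ω m1 : ℂ) = (ω' (-1) : ℂ)) :
    T5EpsilonTwist.epsShape U ϖ' (p : ℂ) n c G s ω *
        T5EpsilonTwist.epsShape U ϖ' (p : ℂ) n c G (1 - s) ω⁻¹ = (ω m1 : ℂ) := by
  have hq : ((Nat.card 𝓀[ℚ_[p]] : ℝ) : ℂ) = (p : ℂ) := by
    rw [card_residueField]; push_cast; rfl
  have hG₁ : G (ω.restrict U) = T5SelfDualGaussSum.kudlaGaussSumSelfDual
      (T5LocalFieldHaar.haar (K := ℚ_[p])) (Nat.card 𝓀[ℚ_[p]] : ℝ) ν (irreducible_p p) ω' h₁ Ψ := by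
    rw [card_residueField]; exact hG
  have hG₂ : G (ω⁻¹.restrict U) = T5SelfDualGaussSum.kudlaGaussSumSelfDual
      (T5LocalFieldHaar.haar (K := ℚ_[p])) (Nat.card 𝓀[ℚ_[p]] : ℝ) ν (irreducible_p p) ω'⁻¹ h₂ Ψ := by
    rw [card_residueField]; exact hG'
  have h := T5EpsilonLocalField.epsShape_mul_epsShape_inv_localField (irreducible_p p) U ϖ' ν n c
    G s ω m1 hc hex hω h₁ h₂ Ψ hΨ hy hG₁ hG₂ hm
  rwa [hq] at h

end Measure

end Summit.Ventures.HodgeRepro2.T5PadicLocalField
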